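import Summits.BirchSwinnertonDyer.Rank1Residual.X2.RankOneNonsplitCertificate
import Summits.BirchSwinnertonDyer.Rank1Residual.X2.RouteGSplitDisplay80934e1Local
import HarnessLib

/-!
# Row B11 = cell X2c (rank 1, Eisenstein multiplicative): ONE INSTANCE in the kernel — `BSD(5415e1, 3)`
# from the λ-minimal non-split certificate road (cell `bsd-eis`, seat `bsd-eis-cgshw` gen 8; route
# `EisensteinPrimes`, crux 4 `BSDpOnCellC` = `X2.TargetC`; K5 tribunal judge note (b)
# «land ONE X2c instance (row B11, rank-1 multiplicative reducible, N > 5000)»; THEOREMS ONLY)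

HONEST FRAMING (FULL-BSD rank-≤1 programme D-0033, cell `bsd-eis`, home `run/shared/lean/pub/bsd-eis/`;
row B11 = X2c: 12 665 census cells `(E, p)` with `r_an = 1`, `p` odd, `p ‖ N`, `E[p]` reducible). Nothing
is booked and no label or count moves: X2c stays CONSTRUCTION-SHAPED as a class. This file runs ONE
pair through the tree's λ-minimal non-split road `X2.bsdp_of_cellC_of_not_split_of_lamMin`
(`X2/RankOneNonsplitCertificate.lean`, b2b-bsdres eisenstein-p2 gen 19: X2c ∧ non-split ∧ `μ_an = 0` ∧
`λ_an = 1` ⟹ `BSD(E,p)`, both parity types, NO Greenberg–Vatsal input, NO congruent partner, NO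
regulator — Kato–Wuthrich divisibility + λ-squeeze give Mazur's main conjecture at the pair AND
Schneider's non-degeneracy; Disegni 2020 Thm. 4 and Stein–Wuthrich 2013 Thm. 6.1 give the two leading
terms).

TARGET `W = 5415e1 = [0, −1, 1, −215, 1256]` (Cremona): `N = 5415 = 3·5·19² > 5000`, `Δ = 3⁶·5³·19²`,
`c₄ = 10336 = 2⁵·17·19`; `r_an = 1`, `#E(ℚ)_tors = 1`, `∏ c_v = 6` (`c₃ = 2`, Kodaira `I₆` non-split),
`Ш_an = 1.000`; isogeny class
`5415e = {e1, e2}` linked by a `3`-isogeny; cc window table `class-closure/O9/LAMMIN-CLASS-typer6.tsv`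
row `5415e1@3`: sub-cell X2c, NON-split, `r = 1`, `(μ_an, λ_an) = (0, 1)`, two engines agree
(A = PARI `ellpadiclambdamu`, B = modular-symbol engine; source `lamMin_X2_verdicts.tsv` sha16
51bf49e8111b5371), verdict λ-minimal «closed@rep»; RE-READ this generation by kit j251254 (cypari2:
`ellpadiclambdamu(E,3) = [λ, μ] = [1, 0]`, `ellap(E,3) = −1`, `ellrootno = −1`, `ellanalyticrank = [1, 3.0551…]`,
`elltors = 1`, `elllocalred(E,3)` = type `I₆`, `c₃ = 2`; outputs attached as evidence on stmt-BirchSwinnertonDyer-19034).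

KERNEL-PROVED here: ellipticity and global minimality of the equation; `W` is multiplicative at `3`
(`3 ∣ Δ`, `3 ∤ c₄`) and NON-split there (node-tangent quadratic `10336t² − 255854 ≡ t² + 1 (mod 3)`
root-free; `a₃ = −1`); `W[3]` is reducible (the rational `Ψ₃`-root `x₀ = −25`, `Ψ₂Sq(−25) = −38475 ≠ 0`:
the `3`-isogeny `5415e1 → 5415e2`); hence `ClassX2 W 3`, `CellC W 3` given the rank. PER-PAIR
CERTIFICATE HYPOTHESES LEFT [instrument]: `hr : r_an(W) = 1` [Cremona `allbsd`; PARI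
`ellanalyticrank`], `hμ0 : μ_an ≤ 0` and `hlam : λ_an = 1` for THE non-split Mazur–Tate–Teitelbaum
function [two engines + kit j251254]. CLASS-LEVEL INPUTS, all REGISTERED Literature facts [PUB],
by name: `hDis` Disegni 2020 Thm. 4, `hWu` Wuthrich 2014 Thm. 16, `hJs hJn hHs hHn` Stein–Wuthrich 2013
Thm. 6.1 / §4.2, `hGZ` Gross–Zagier I.7.3, `hGZK` rank part of BSD in analytic rank ≤ 1, `hpar` modular
parametrisation. No `_OPEN` fact, no `@[conjecture]`, no Schneider hypothesis.

What this is NOT: not a booking of `(5415e1, 3)`; not the crux `BSDpOnCellC` (which is the CLASS);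
not K2ᴱ / road H (the class-wide construction) — a per-pair certificate closure showing the cell of
crux 4 is inhabited by pairs the tree's published-input roads already reach.
Refs: [Disegni2020] Thm. 4 (§3.2); [Wuthrich2014] Thm. 16 (p. 397); [SteinWuthrich2013] Thm. 6.1
(p. 20), §4.2; [SilvermanAEC2009] VII.1 Rem. 1.1, VII.5 Prop. 5.1(b); Cremona `ecdata` (allcurves /
allbsd / allisog, class 5415e).
-/

set_option autoImplicit false

noncomputable section

open scoped Classical

open WeierstrassCurve NumberField IsDedekindDomain
  Literature.NumberTheory.EllipticCurves
  Literature.NumberTheory.EllipticCurves.ModularForms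
  Literature.NumberTheory.EllipticCurves.Rank1Residual
  Literature.NumberTheory.EllipticCurves.Rank1Residual.Typed
  Literature.NumberTheory.EllipticCurves.Wuthrich2014
  Literature.NumberTheory.EllipticCurves.SteinWuthrich2013
  Literature.NumberTheory.EllipticCurves.Disegni2020
  Summit.BirchSwinnertonDyer.BirchSwinnertonDyer.Rank1Residual.IntModel
  Summit.BirchSwinnertonDyer.BirchSwinnertonDyer.Rank1Residual.X11RankOne
  Summit.BirchSwinnertonDyer.Rank1Residual.X11b
  Summit.BirchSwinnertonDyer.Rank1Residual

namespace Summit.BirchSwinnertonDyer.Rank1Residual.X2.RankOneNonsplitDisplay5415e1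

/-! ## §1 The equation: elliptic, globally minimal, NON-split multiplicative at `3` -/

/-- `5415e1 = [0, −1, 1, −215, 1256]` is elliptic (`Δ = 32896125 ≠ 0`). [folklore] -/
theorem isElliptic_5415e1 : (⟨0, -1, 1, -215, 1256⟩ : WeierstrassCurve ℚ).IsElliptic :=
  isElliptic_of_discOf_ne_zero 0 (-1) 1 (-215) 1256 (by decide +kernel)

set_option maxRecDepth 100000 in
/-- `5415e1` is globally minimal (bounded Kraus–Silverman criterion, `decide`).
[cite: SilvermanAEC2009, VII.1 Remark 1.1] -/
theorem isGloballyMinimal_5415e1 : (⟨0, -1, 1, -215, 1256⟩ : WeierstrassCurve ℚ).IsGloballyMinimal :=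
  isGloballyMinimal_of_krausCriterion_bounded 0 (-1) 1 (-215) 1256
    (by decide +kernel) (by decide +kernel) (by decide +kernel)

/-- **`5415e1` is NON-split multiplicative at `3`** (`3 ∣ Δ = 3⁶·5³·19²`, `3 ∤ c₄ = 10336`; the
node-tangent quadratic `10336t² − 255854 ≡ t² + 1 (mod 3)` is root-free; `a₃ = −1`). [cite: SilvermanAEC2009, VII.5 Prop. 5.1(b)] -/
theorem nonsplit_5415e1 : (⟨0, -1, 1, -215, 1256⟩ : WeierstrassCurve ℚ).HasMultiplicativeReductionAtPrime 3 ∧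
    ¬ (⟨0, -1, 1, -215, 1256⟩ : WeierstrassCurve ℚ).HasSplitMultiplicativeReductionAtPrime 3 := by
  haveI := isElliptic_5415e1
  haveI := isGloballyMinimal_5415e1
  have hI := integralModelInt_eq_of_map_eq (W := (⟨0, -1, 1, -215, 1256⟩ : WeierstrassCurve ℚ)) _
    (map_mk_int 0 (-1) 1 (-215) 1256)
  exact ⟨hasMultiplicativeReductionAtPrime_of_intModel hI 3 (by rw [intCurve_Δ]; decide +kernel)
      (by rw [intCurve_c₄]; decide +kernel),
    not_hasSplitMultiplicativeReductionAtPrime_of_intModel_of_noroot hI 3 (by rw [intCurve_Δ]; decide +kernel)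
      (by rw [intCurve_c₄]; decide +kernel) (fun t ↦ by
        simp only [WeierstrassCurve.c₄, WeierstrassCurve.b₂, WeierstrassCurve.b₄, WeierstrassCurve.b₆]
        push_cast; revert t; decide)⟩

/-! ## §2 The Galois side: `5415e1[3]` is reducible -/

/-- **`5415e1[3]` is reducible — IN THE KERNEL**: `x₀ = −25` is a rational root of `Ψ₃` with
`Ψ₂Sq(−25) = −38475 ≠ 0` (the kernel of the `3`-isogeny `5415e1 → 5415e2 = [0, −1, 1, −17315, 882761]`
is a rational line). [folklore] -/
theorem not_irreducible_5415e1 : ¬ (⟨0, -1, 1, -215, 1256⟩ : WeierstrassCurve ℚ).HasIrreducibleModPGaloisRep 3 := by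
  haveI := isElliptic_5415e1
  obtain ⟨Φ, P, y, h, hΦ, -⟩ :=
    KernelDisc.exists_isRationalLine_of_eval_Ψ₃_eq_zero (W := ⟨0, -1, 1, -215, 1256⟩) (-25)
      (by norm_num [WeierstrassCurve.Ψ₃, WeierstrassCurve.b₂, WeierstrassCurve.b₄, WeierstrassCurve.b₆,
            WeierstrassCurve.b₈])
      (by rw [KernelDisc.eval_Ψ₂Sq]; norm_num [WeierstrassCurve.b₂, WeierstrassCurve.b₄, WeierstrassCurve.b₆])
  exact not_hasIrreducibleModPGaloisRep_of_isRationalLine hΦ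

/-- **`(5415e1, 3)` lies in class X2** (`3` odd, `E[3]` reducible, `3 ‖ N` multiplicative) — in the
kernel. [folklore] -/
theorem classX2_5415e1 : ClassX2 (⟨0, -1, 1, -215, 1256⟩ : WeierstrassCurve ℚ) 3 :=
  ⟨by decide, not_irreducible_5415e1, nonsplit_5415e1.1⟩

/-! ## §3 The display: `BSD(5415e1, 3)` -/

/-- **X2c INSTANCE — `BSD(5415e1, 3)`** (row B11: `r_an = 1`, Eisenstein, NON-split multiplicative
`3 ‖ N = 5415 > 5000`), by the tree's λ-minimal non-split road
`X2.bsdp_of_cellC_of_not_split_of_lamMin`: `CellC W 3` holds in the kernel given the rank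
(`classX2_5415e1`); class-level binders are REGISTERED Literature facts [PUB] by name (Disegni 2020
Thm. 4, Wuthrich 2014 Thm. 16, Stein–Wuthrich 2013 Thm. 6.1 both signs + canonical heights,
Gross–Zagier I.7.3, rank part of BSD, modular parametrisation); CONDITIONAL only on the per-pair
INSTRUMENT certificates `hr : r_an = 1` [Cremona allbsd / PARI] and `hμ0`, `hlam` : `(μ_an, λ_an) =
(0, 1)` for THE non-split Mazur–Tate–Teitelbaum `3`-adic `L`-function [cc window table
`O9/LAMMIN-CLASS-typer6.tsv` row `5415e1@3`, two engines; kit j251254]. No Greenberg–Vatsal parity, no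
partner, no regulator, no Schneider hypothesis, no `_OPEN` fact. Nothing booked.
[cite: Disegni2020, Thm. 4 (§3.2)] [cite: Wuthrich2014, Thm. 16 (p. 397)]
[cite: SteinWuthrich2013, Thm. 6.1 (p. 20), §3.1 (p. 9), §4.2] [cite: Miller2011LMS, Def. 1.1 and Prop. 7.6] -/
theorem bsdp_5415e1_at_three
    (hDis : padicBSD_rankOne_nonsplitMult) (hWu : thm16_charIdeal_dvd_multiplicative_of_reducible)
    (hJs : thm61_splitMultiplicative) (hJn : thm61_nonsplitMultiplicative)
    (hHs : exists_isSplitMultCanonical) (hHn : exists_isMultCanonical)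
    (hGZ : GrossZagier1986_thm_I_7_3) (hGZK : rank_eq_analyticRank_of_analyticRank_le_one)
    (hpar : nonempty_modularParametrizationData)
    (W : WeierstrassCurve ℚ) [W.IsElliptic] [W.IsGloballyMinimal] (hW : W = ⟨0, -1, 1, -215, 1256⟩)
    (hr : W.analyticRank = 1) (hμ0 : AnalyticMuLE W 3 0) (hlam : AnalyticLambdaEq W 3 1) :
    BSDp W 3 := by
  subst hW
  exact bsdp_of_cellC_of_not_split_of_lamMin _ 3 hDis hWu hJs hJn hHs hHn hGZ hGZK hpar
    ⟨hr, classX2_5415e1⟩ nonsplit_5415e1.2 hμ0 hlam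

/-- **The same instance, stated on the route's cell predicate**: `CellC 5415e1 3 → BSD(5415e1, 3)`
modulo the published facts and the two `L`-function certificates — i.e. the pair `(5415e1, 3)`
satisfies crux 4's `X2.TargetC` shape `CellC W p → BSDp W p` (the analytic-rank clause of `CellC`
supplies `hr`). [cite: Disegni2020, Thm. 4 (§3.2)] [cite: Wuthrich2014, Thm. 16 (p. 397)]
[cite: SteinWuthrich2013, Thm. 6.1 (p. 20), §4.2] -/
theorem targetC_5415e1_at_three
    (hDis : padicBSD_rankOne_nonsplitMult) (hWu : thm16_charIdeal_dvd_multiplicative_of_reducible)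
    (hJs : thm61_splitMultiplicative) (hJn : thm61_nonsplitMultiplicative)
    (hHs : exists_isSplitMultCanonical) (hHn : exists_isMultCanonical)
    (hGZ : GrossZagier1986_thm_I_7_3) (hGZK : rank_eq_analyticRank_of_analyticRank_le_one)
    (hpar : nonempty_modularParametrizationData)
    (W : WeierstrassCurve ℚ) [W.IsElliptic] [W.IsGloballyMinimal] (hW : W = ⟨0, -1, 1, -215, 1256⟩)
    (hμ0 : AnalyticMuLE W 3 0) (hlam : AnalyticLambdaEq W 3 1) :
    CellC W 3 → BSDp W 3 :=
  fun hc ↦ bsdp_5415e1_at_three hDis hWu hJs hJn hHs hHn hGZ hGZK hpar W hW hc.1 hμ0 hlam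

end Summit.BirchSwinnertonDyer.Rank1Residual.X2.RankOneNonsplitDisplay5415e1

end
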